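import Mathlib
import Summits.Ventures.HodgeRepro.Tier4.Target

/-!
# Tier4/Line3/DefiniteBound — a Gram entry large at a definite place makes the definite Gaussian small
(rung for L3.4 / L3.5)

Blind re-derivation cell `pub-hodge-repro`, Tier 4 «PROVE THE STEP» (README §9–§10), LINE L3, seat t4-L2-p3 on L3.5
`term_dominated` (lead S12234).

Step 5 of LINE L3, second case: the Gram deviation of an off-main tuple is large at a DEFINITE embedding `σ` of `E′`
(`OffMainOrbit.exists_gram_dev_size`).  Then the coefficient function's Gaussian at `σ` — the factor
`exp(−c₀ Σ_i ‖σ (x i)‖²)` of `gaussDefAt c₀ x` (Skeleton v0.16 `Loc.growth`) — is small on the two slots concerned.  The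
two Mathlib-level steps:

* `norm_map_hform_le` — `‖σ ⟨x, x'⟩_H‖ ≤ K_σ · (Σ_k ‖σ (x k)‖² + Σ_l ‖σ (x' l)‖²)` with `K_σ = Σ_{k,l} ‖σ (H k l)‖`, for any
  embedding `σ` with `‖σ (c t)‖ = ‖σ t‖` (every complex embedding of a CM field);
* `finprod_cond_exp_le` — a finite product `∏ᶠ (σ) (_ : P σ), exp(−f σ)` of Gaussians (`f ≥ 0`) is at most any one of
  its factors (the shape of `gaussDefAt`, bounded by the single place `σ`);
* `exp_mul_le_of_norm_ge` — the combination: `R ≤ ‖σ ⟨x, x'⟩_H‖` gives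
  `exp(−c₀ Σ‖σ (x k)‖²) · exp(−c₀ Σ‖σ (x' l)‖²) ≤ exp(−c₀ R / K_σ)`.

Nothing here asserts anything about the truth of (P); HC_CM is NOT proved by anyone in this repository.
-/

set_option autoImplicit false

namespace Summit.Ventures.HodgeRepro.Tier4.Line3

open Matrix

section DefiniteBound

variable {E : Type*} [Field E]

/-- **The hermitian form at an embedding is bounded by the squared sizes.** For an embedding `σ : E →+* ℂ` with
`‖σ (c t)‖ = ‖σ t‖`, `‖σ ⟨x, x'⟩_H‖ ≤ (Σ_{k,l} ‖σ (H k l)‖) · (Σ_k ‖σ (x k)‖² + Σ_l ‖σ (x' l)‖²)`. -/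
theorem norm_map_hform_le (c : E ≃+* E) (H : Matrix (Fin 3) (Fin 3) E) (σ : E →+* ℂ)
    (hσc : ∀ t, ‖σ (c t)‖ = ‖σ t‖) (x x' : Fin 3 → E) :
    ‖σ (hform c H x x')‖ ≤ (∑ k, ∑ l, ‖σ (H k l)‖) * ((∑ k, ‖σ (x k)‖ ^ 2) + ∑ l, ‖σ (x' l)‖ ^ 2) := by
  -- `σ ⟨x, x'⟩ = Σ_k Σ_l σ(c x_k) σ(H_kl) σ(x'_l)`
  have hexp : σ (hform c H x x') = ∑ k, ∑ l, σ (c (x k)) * σ (H k l) * σ (x' l) := by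
    simp only [hform, dotProduct, Matrix.mulVec, map_sum, map_mul, Finset.mul_sum, mul_assoc]
  rw [hexp]
  -- termwise: `‖σ(c x_k)‖ ‖σ H_kl‖ ‖σ x'_l‖ ≤ ‖σ H_kl‖ (‖σ x_k‖² + ‖σ x'_l‖²)` (`2ab ≤ a² + b²`, and `1 ≤ 2`)
  have hterm : ∀ k l, ‖σ (c (x k)) * σ (H k l) * σ (x' l)‖ ≤
      ‖σ (H k l)‖ * ((∑ k, ‖σ (x k)‖ ^ 2) + ∑ l, ‖σ (x' l)‖ ^ 2) := by
    intro k l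
    rw [norm_mul, norm_mul, hσc]
    have hab : ‖σ (x k)‖ * ‖σ (x' l)‖ ≤ (∑ k, ‖σ (x k)‖ ^ 2) + ∑ l, ‖σ (x' l)‖ ^ 2 := by
      have h1 : ‖σ (x k)‖ ^ 2 ≤ ∑ k, ‖σ (x k)‖ ^ 2 :=
        Finset.single_le_sum (f := fun i => ‖σ (x i)‖ ^ 2) (fun i _ => sq_nonneg _) (Finset.mem_univ k)
      have h2 : ‖σ (x' l)‖ ^ 2 ≤ ∑ l, ‖σ (x' l)‖ ^ 2 :=
        Finset.single_le_sum (f := fun i => ‖σ (x' i)‖ ^ 2) (fun i _ => sq_nonneg _) (Finset.mem_univ l)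
      nlinarith [sq_nonneg (‖σ (x k)‖ - ‖σ (x' l)‖), norm_nonneg (σ (x k)), norm_nonneg (σ (x' l))]
    calc ‖σ (x k)‖ * ‖σ (H k l)‖ * ‖σ (x' l)‖ = ‖σ (H k l)‖ * (‖σ (x k)‖ * ‖σ (x' l)‖) := by ring
      _ ≤ ‖σ (H k l)‖ * ((∑ k, ‖σ (x k)‖ ^ 2) + ∑ l, ‖σ (x' l)‖ ^ 2) :=
        mul_le_mul_of_nonneg_left hab (norm_nonneg _)
  calc ‖∑ k, ∑ l, σ (c (x k)) * σ (H k l) * σ (x' l)‖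
      ≤ ∑ k, ∑ l, ‖σ (c (x k)) * σ (H k l) * σ (x' l)‖ := by
        refine (norm_sum_le _ _).trans (Finset.sum_le_sum fun k _ => norm_sum_le _ _)
    _ ≤ ∑ k, ∑ l, ‖σ (H k l)‖ * ((∑ k, ‖σ (x k)‖ ^ 2) + ∑ l, ‖σ (x' l)‖ ^ 2) :=
        Finset.sum_le_sum fun k _ => Finset.sum_le_sum fun l _ => hterm k l
    _ = (∑ k, ∑ l, ‖σ (H k l)‖) * ((∑ k, ‖σ (x k)‖ ^ 2) + ∑ l, ‖σ (x' l)‖ ^ 2) := by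
        simp only [Finset.sum_mul]

/-- **A finite product of Gaussians is at most any one factor.** -/
theorem finprod_cond_exp_le {ι : Type*} [Finite ι] (P : ι → Prop) (f : ι → ℝ) (hf : ∀ σ, 0 ≤ f σ) (σ₁ : ι)
    (h₁ : P σ₁) : (∏ᶠ (σ) (_ : P σ), Real.exp (-f σ)) ≤ Real.exp (-f σ₁) := by
  classical
  haveI := Fintype.ofFinite ι
  have hfin : (∏ᶠ (σ) (_ : P σ), Real.exp (-f σ)) = ∏ σ ∈ Finset.univ.filter P, Real.exp (-f σ) :=
    finprod_cond_eq_prod_of_cond_iff _ fun {σ} _ => by simp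
  rw [hfin]
  have hmem : σ₁ ∈ Finset.univ.filter P := by simp [h₁]
  rw [← Finset.mul_prod_erase _ _ hmem]
  refine mul_le_of_le_one_right (Real.exp_pos _).le ?_
  refine Finset.prod_le_one (fun σ _ => (Real.exp_pos _).le) fun σ _ => ?_
  rw [Real.exp_le_one_iff]
  linarith [hf σ]

/-- **THE DEFINITE GAUSSIAN IS SMALL WHERE THE GRAM ENTRY IS LARGE.** If `R ≤ ‖σ ⟨x, x'⟩_H‖`, `0 < c₀` and
`K = Σ_{k,l} ‖σ (H k l)‖`, then `exp(−c₀ Σ_k ‖σ (x k)‖²) · exp(−c₀ Σ_l ‖σ (x' l)‖²) ≤ exp(−c₀ R / K)` (for `K > 0`; if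
`K = 0` the form vanishes and `R ≤ 0`). -/
theorem exp_mul_le_of_norm_ge (c : E ≃+* E) (H : Matrix (Fin 3) (Fin 3) E) (σ : E →+* ℂ)
    (hσc : ∀ t, ‖σ (c t)‖ = ‖σ t‖) (x x' : Fin 3 → E) (c₀ R : ℝ) (hc₀ : 0 < c₀)
    (hK : 0 < ∑ k, ∑ l, ‖σ (H k l)‖) (hR : R ≤ ‖σ (hform c H x x')‖) :
    Real.exp (-(c₀ * ∑ k, ‖σ (x k)‖ ^ 2)) * Real.exp (-(c₀ * ∑ l, ‖σ (x' l)‖ ^ 2)) ≤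
      Real.exp (-(c₀ * R / (∑ k, ∑ l, ‖σ (H k l)‖))) := by
  rw [← Real.exp_add]
  apply Real.exp_le_exp.mpr
  have h := (hR.trans (norm_map_hform_le c H σ hσc x x'))
  -- `R / K ≤ S(x) + S(x')`
  have h' : R / (∑ k, ∑ l, ‖σ (H k l)‖) ≤ (∑ k, ‖σ (x k)‖ ^ 2) + ∑ l, ‖σ (x' l)‖ ^ 2 := by
    rw [div_le_iff₀ hK]
    linarith [h]
  have := mul_le_mul_of_nonneg_left h' hc₀.le
  rw [mul_div_assoc]
  linarith [this]

end DefiniteBound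

end Summit.Ventures.HodgeRepro.Tier4.Line3
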